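import Summits.QuantumFields.YangMills.Theorems.AllWindowsColdBoxCubicChaosSecondMoment

/-!
# `ConnectedThreePoint`, quadratic vertices (U5-BLOCKERS §2, lift L2): the exact third joint cumulant of THREE QUADRATIC
# FORMS of a centred Gaussian process — only the EIGHT CONNECTED Wick pairings survive

Width seat `ym-line-sfw-p2-w3` (g41), cell ym-idea-1; U5 prep, helper-grade (planner ym-idea-2 g18 BOARD 2026-08-29T22:22:10Z «L2 open: evaluate
the even part of `f′(0)` EXACTLY by Wick (connected 3-point diagrams) instead of Cauchy–Schwarz — Props ConnectedThreePoint + GhostKernelEntries»).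

For a centred Gaussian process `X : T → Ω → ℝ` (Mathlib `IsGaussianProcess`, `E X_t = 0`), finitely many legs `t : κ → T` with two-point function
`C a b = E[X_{t a} X_{t b}]`, and three coefficient matrices `A B M : κ → κ → ℝ` with quadratic forms `Q_A = Σ_{aa'} A_{aa'} X_{t a} X_{t a'}` etc.:

* `integral_quadForm` — `E[Q_A] = Σ A_{aa'} C_{aa'}`; `integral_quadForm_mul_quadForm` — `E[Q_AQ_B]` = the three pairings of four legs;
  `integral_quadForm_mul_quadForm_mul_quadForm` — `E[Q_AQ_BQ_M]` = the fifteen pairings of six legs (✓`CubicChaos.integral_prod_six` +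
  ✓`GaussianWick.integral_prod_four`, exactly as the tree proves the six-point case);
* ★★ `cum3_quadForm_eq` — **the third joint cumulant**
  `E[Q_AQ_BQ_M] − E[Q_A]E[Q_BQ_M] − E[Q_B]E[Q_AQ_M] − E[Q_M]E[Q_AQ_B] + 2E[Q_A]E[Q_B]E[Q_M]
   = Σ_{aa'bb'cc'} A_{aa'}B_{bb'}M_{cc'}·(C_{ab}C_{a'c}C_{b'c'} + C_{ab}C_{a'c'}C_{b'c} + C_{ab'}C_{a'c}C_{bc'} + C_{ab'}C_{a'c'}C_{bc}
                                        + C_{ac}C_{a'b}C_{b'c'} + C_{ac}C_{a'b'}C_{bc'} + C_{ac'}C_{a'b}C_{b'c} + C_{ac'}C_{a'b'}C_{bc})`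
  — of the 15 pairings of the six legs, the 7 containing a line inside one form cancel identically against the subtracted products (a pointwise
  polynomial identity in the 15 values of `C`), the 8 CONNECTED ones (every form linked to both others: a triangle `A–B–M`) survive;
* ★ `cum3_quadForm_eq_symm` — for symmetric `A, B, M` all eight triangles coincide after relabelling inside each form:
  `… = 8·Σ_{aa'bb'cc'} A_{aa'}B_{bb'}M_{cc'}·C_{a'b}C_{b'c}C_{c'a}` (`= 8·tr(ACBCMC)`; S. Janson, *Gaussian Hilbert Spaces*, Thm 1.28/1.36:
  `κ₃(ξᵀAξ, ξᵀBξ, ξᵀMξ) = 8·tr(AΣBΣMΣ)`).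
In the edge chart (`C = (2β)⁻¹·(hodgeQ H ⊗ 1₃)⁻¹`, ✓`EdgeChartWick`) this reads `κ₃ = β⁻³·tr(A·G·B·G·M·G)`, `G = (hodgeQ H ⊗ 1)⁻¹`: the exact value of the
even×even×even part of `f′(0) = κ₃(c₀, c_T, U)` (ASSEMBLY-S5 (e4)) for the QUADRATIC vertices of `U_even` (ghost form `quadVal M_H`, Haar `Σ‖a_e‖²`) against
the Gaussian parts `linCurvSq` of the two plaquette observables — two propagators `p₀ → vertex → p_T` and one `p_T → p₀`, instead of the Cauchy–Schwarz size
`‖c̃₀c̃_T‖₂‖Ũ_even‖₂ ~ β⁻²·H⁴/β` of blocker B2.  The chart/`gaussAvg` transcription and the quartic vertices (`W₄`, `Φ⁴`: connected 8-leg pairings) are NOT in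
this file.

Pure Mathlib + the tree's ✓`GaussianWickTheorem` / ✓`AllWindowsColdBoxCubicChaosSecondMoment`; no definitions; standard axioms.  HONEST LABEL: a probabilistic
tool for the RECORDED lift L2 of the NEXT rung U5 (⟨stmt-QuantumFields-24336⟩, UNSTAFFED); ⟨24004⟩ ⟨24336⟩ remain OPEN; route AllWindowsColdBox is DRAFT;
no crux, rung or summit is proved; **the Yang–Mills mass gap is NOT proved by this file; no summit is proved by a line.**
-/

set_option autoImplicit false

noncomputable section

open MeasureTheory ProbabilityTheory Finset
open Literature.Probability.Distributions.GaussianWick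
open Summit.QuantumFields.YangMills.Theorems.AllWindowsColdBox.CubicChaos (integrable_mul_six integral_mul_four integral_prod_six)

namespace Summit.QuantumFields.YangMills.Theorems.AllWindowsColdBoxBoxHighLine

namespace QuadCum3

variable {T Ω : Type*} {mΩ : MeasurableSpace Ω} {P : Measure Ω} {X : T → Ω → ℝ}

/-! ## Two and four legs -/

/-- A product of two coordinates of a Gaussian process is integrable. -/
theorem integrable_mul_two (hX : IsGaussianProcess X P) (p q : T) : Integrable (fun ω => X p ω * X q ω) P := by
  have h := integrable_prod hX (Finset.univ : Finset (Fin 2)) ![p, q]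
  refine h.congr (ae_of_all _ fun ω => ?_)
  simp only [Fin.prod_univ_two]
  rfl

/-- A product of four coordinates of a Gaussian process is integrable. -/
theorem integrable_mul_four (hX : IsGaussianProcess X P) (p q r s : T) :
    Integrable (fun ω => X p ω * X q ω * X r ω * X s ω) P := by
  have h := integrable_prod hX (Finset.univ : Finset (Fin 4)) ![p, q, r, s]
  refine h.congr (ae_of_all _ fun ω => ?_)
  simp only [Fin.prod_univ_four]
  rfl

/-! ## Finite sums: bookkeeping -/

section Sums

variable {κ : Type*} [Fintype κ]

/-- Pointwise rewriting under a four-fold sum. -/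
theorem sum4_congr {f g : κ → κ → κ → κ → ℝ} (h : ∀ a a' b b', f a a' b b' = g a a' b b') :
    (∑ a, ∑ a', ∑ b, ∑ b', f a a' b b') = ∑ a, ∑ a', ∑ b, ∑ b', g a a' b b' := by
  simp only [h]

/-- Pointwise rewriting under a six-fold sum. -/
theorem sum6_congr {f g : κ → κ → κ → κ → κ → κ → ℝ} (h : ∀ a a' b b' c c', f a a' b b' c c' = g a a' b b' c c') :
    (∑ a, ∑ a', ∑ b, ∑ b', ∑ c, ∑ c', f a a' b b' c c') = ∑ a, ∑ a', ∑ b, ∑ b', ∑ c, ∑ c', g a a' b b' c c' := by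
  simp only [h]

/-- A four-fold sum as one sum over `κ⁴`. -/
theorem sum4_eq_sum_prod (f : κ → κ → κ → κ → ℝ) :
    (∑ a, ∑ a', ∑ b, ∑ b', f a a' b b') = ∑ z : κ × κ × κ × κ, f z.1 z.2.1 z.2.2.1 z.2.2.2 := by
  simp only [Fintype.sum_prod_type]

/-- A six-fold sum as one sum over `κ⁶`. -/
theorem sum6_eq_sum_prod (f : κ → κ → κ → κ → κ → κ → ℝ) :
    (∑ a, ∑ a', ∑ b, ∑ b', ∑ c, ∑ c', f a a' b b' c c') =
      ∑ z : κ × κ × κ × κ × κ × κ, f z.1 z.2.1 z.2.2.1 z.2.2.2.1 z.2.2.2.2.1 z.2.2.2.2.2 := by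
  simp only [Fintype.sum_prod_type]

/-- `(Σ_{aa'} f)(Σ_{bb'} g) = Σ_{aa'bb'} f·g` (binders in this order). -/
theorem sum2_mul_sum2 (f g : κ → κ → ℝ) :
    (∑ a, ∑ a', f a a') * (∑ b, ∑ b', g b b') = ∑ a, ∑ a', ∑ b, ∑ b', f a a' * g b b' := by
  rw [Finset.sum_mul]; refine Finset.sum_congr rfl fun a _ => ?_
  rw [Finset.sum_mul]; refine Finset.sum_congr rfl fun a' _ => ?_
  rw [Finset.mul_sum]; refine Finset.sum_congr rfl fun b _ => ?_
  rw [Finset.mul_sum]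

/-- `(Σ_{aa'} f)(Σ_{bb'cc'} g) = Σ_{aa'bb'cc'} f·g` (binders in this order). -/
theorem sum2_mul_sum4 (f : κ → κ → ℝ) (g : κ → κ → κ → κ → ℝ) :
    (∑ a, ∑ a', f a a') * (∑ b, ∑ b', ∑ c, ∑ c', g b b' c c') =
      ∑ a, ∑ a', ∑ b, ∑ b', ∑ c, ∑ c', f a a' * g b b' c c' := by
  rw [Finset.sum_mul]; refine Finset.sum_congr rfl fun a _ => ?_
  rw [Finset.sum_mul]; refine Finset.sum_congr rfl fun a' _ => ?_
  rw [Finset.mul_sum]; refine Finset.sum_congr rfl fun b _ => ?_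
  rw [Finset.mul_sum]; refine Finset.sum_congr rfl fun b' _ => ?_
  rw [Finset.mul_sum]; refine Finset.sum_congr rfl fun c _ => ?_
  rw [Finset.mul_sum]

/-- `(Σ_{aa'bb'} g)(Σ_{cc'} f) = Σ_{aa'bb'cc'} g·f` (binders in this order). -/
theorem sum4_mul_sum2 (g : κ → κ → κ → κ → ℝ) (f : κ → κ → ℝ) :
    (∑ a, ∑ a', ∑ b, ∑ b', g a a' b b') * (∑ c, ∑ c', f c c') =
      ∑ a, ∑ a', ∑ b, ∑ b', ∑ c, ∑ c', g a a' b b' * f c c' := by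
  rw [Finset.sum_mul]; refine Finset.sum_congr rfl fun a _ => ?_
  rw [Finset.sum_mul]; refine Finset.sum_congr rfl fun a' _ => ?_
  rw [Finset.sum_mul]; refine Finset.sum_congr rfl fun b _ => ?_
  rw [Finset.sum_mul]; refine Finset.sum_congr rfl fun b' _ => ?_
  rw [Finset.mul_sum]; refine Finset.sum_congr rfl fun c _ => ?_
  rw [Finset.mul_sum]

/-- `(Σ_{aa'} f)(Σ_{bb'} g)(Σ_{cc'} h) = Σ_{aa'bb'cc'} f·g·h` (binders in this order). -/
theorem sum2_mul_sum2_mul_sum2 (f g h : κ → κ → ℝ) :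
    (∑ a, ∑ a', f a a') * (∑ b, ∑ b', g b b') * (∑ c, ∑ c', h c c') =
      ∑ a, ∑ a', ∑ b, ∑ b', ∑ c, ∑ c', f a a' * g b b' * h c c' := by
  rw [sum2_mul_sum2 f g, sum4_mul_sum2]

/-- Moving the middle pair of binders of a four-fold sum to the front. -/
theorem sum4_comm22 (h : κ → κ → κ → κ → ℝ) :
    (∑ c, ∑ c', ∑ b, ∑ b', h b b' c c') = ∑ b, ∑ b', ∑ c, ∑ c', h b b' c c' := by
  calc (∑ c, ∑ c', ∑ b, ∑ b', h b b' c c') = ∑ c, ∑ b, ∑ c', ∑ b', h b b' c c' :=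
        Finset.sum_congr rfl fun c _ => Finset.sum_comm
    _ = ∑ b, ∑ c, ∑ c', ∑ b', h b b' c c' := Finset.sum_comm
    _ = ∑ b, ∑ c, ∑ b', ∑ c', h b b' c c' :=
        Finset.sum_congr rfl fun b _ => Finset.sum_congr rfl fun c _ => Finset.sum_comm
    _ = ∑ b, ∑ b', ∑ c, ∑ c', h b b' c c' := Finset.sum_congr rfl fun b _ => Finset.sum_comm

/-- Relabelling `a ↔ a'` inside the first form. -/
theorem sum6_swap_a (F : κ → κ → κ → κ → κ → κ → ℝ) :
    (∑ a, ∑ a', ∑ b, ∑ b', ∑ c, ∑ c', F a a' b b' c c') = ∑ a, ∑ a', ∑ b, ∑ b', ∑ c, ∑ c', F a' a b b' c c' :=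
  Finset.sum_comm

/-- Relabelling `b ↔ b'` inside the second form. -/
theorem sum6_swap_b (F : κ → κ → κ → κ → κ → κ → ℝ) :
    (∑ a, ∑ a', ∑ b, ∑ b', ∑ c, ∑ c', F a a' b b' c c') = ∑ a, ∑ a', ∑ b, ∑ b', ∑ c, ∑ c', F a a' b' b c c' :=
  Finset.sum_congr rfl fun _ _ => Finset.sum_congr rfl fun _ _ => Finset.sum_comm

/-- Relabelling `c ↔ c'` inside the third form. -/
theorem sum6_swap_c (F : κ → κ → κ → κ → κ → κ → ℝ) :
    (∑ a, ∑ a', ∑ b, ∑ b', ∑ c, ∑ c', F a a' b b' c c') = ∑ a, ∑ a', ∑ b, ∑ b', ∑ c, ∑ c', F a a' b b' c' c :=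
  Finset.sum_congr rfl fun _ _ => Finset.sum_congr rfl fun _ _ =>
    Finset.sum_congr rfl fun _ _ => Finset.sum_congr rfl fun _ _ => Finset.sum_comm

end Sums

/-! ## The Gaussian moments of one, two and three quadratic forms -/

section Moments

variable {κ : Type*} [Fintype κ]

/-- **First moment**: `E[Q_A] = Σ_{aa'} A_{aa'} C_{aa'}`. -/
theorem integral_quadForm (hX : IsGaussianProcess X P) (t : κ → T) (C : κ → κ → ℝ)
    (hC : ∀ a b, C a b = ∫ ω, X (t a) ω * X (t b) ω ∂P) (A : κ → κ → ℝ) {QA : Ω → ℝ}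
    (hQA : ∀ ω, QA ω = ∑ a, ∑ a', A a a' * (X (t a) ω * X (t a') ω)) :
    ∫ ω, QA ω ∂P = ∑ a, ∑ a', A a a' * C a a' := by
  simp_rw [hQA]
  rw [integral_finsetSum _ fun a _ => integrable_finsetSum _ fun a' _ => (integrable_mul_two hX _ _).const_mul _]
  refine Finset.sum_congr rfl fun a _ => ?_
  rw [integral_finsetSum _ fun a' _ => (integrable_mul_two hX _ _).const_mul _]
  refine Finset.sum_congr rfl fun a' _ => ?_
  rw [integral_const_mul, ← hC]

/-- **Second moment** (three pairings): `E[Q_AQ_B] = Σ A_{aa'}B_{bb'}(C_{aa'}C_{bb'} + C_{ab}C_{a'b'} + C_{ab'}C_{a'b})`. -/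
theorem integral_quadForm_mul_quadForm (hX : IsGaussianProcess X P) (h0 : ∀ s, ∫ ω, X s ω ∂P = 0) (t : κ → T)
    (C : κ → κ → ℝ) (hC : ∀ a b, C a b = ∫ ω, X (t a) ω * X (t b) ω ∂P) (A B : κ → κ → ℝ) {QA QB : Ω → ℝ}
    (hQA : ∀ ω, QA ω = ∑ a, ∑ a', A a a' * (X (t a) ω * X (t a') ω))
    (hQB : ∀ ω, QB ω = ∑ b, ∑ b', B b b' * (X (t b) ω * X (t b') ω)) :
    ∫ ω, QA ω * QB ω ∂P =
      ∑ a, ∑ a', ∑ b, ∑ b', A a a' * B b b' * (C a a' * C b b' + C a b * C a' b' + C a b' * C a' b) := by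
  classical
  have hprod : ∀ ω, QA ω * QB ω = ∑ a, ∑ a', ∑ b, ∑ b', A a a' * B b b' *
      (X (t a) ω * X (t a') ω * X (t b) ω * X (t b') ω) := by
    intro ω
    rw [hQA ω, hQB ω, sum2_mul_sum2]
    exact sum4_congr fun _ _ _ _ => by ring
  simp_rw [hprod]
  have hint : ∀ a a' b b', Integrable (fun ω => A a a' * B b b' *
      (X (t a) ω * X (t a') ω * X (t b) ω * X (t b') ω)) P := fun a a' b b' =>
    (integrable_mul_four hX _ _ _ _).const_mul _
  have hswap : ∫ ω, ∑ a, ∑ a', ∑ b, ∑ b', A a a' * B b b' * (X (t a) ω * X (t a') ω * X (t b) ω * X (t b') ω) ∂P =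
      ∑ a, ∑ a', ∑ b, ∑ b', ∫ ω, A a a' * B b b' * (X (t a) ω * X (t a') ω * X (t b) ω * X (t b') ω) ∂P := by
    simp_rw [sum4_eq_sum_prod]
    rw [integral_finsetSum _ fun z _ => hint _ _ _ _]
  rw [hswap]
  refine sum4_congr fun a a' b b' => ?_
  rw [integral_const_mul, integral_mul_four hX h0]
  simp only [← hC]

/-- **Third moment** (fifteen pairings): `E[Q_AQ_BQ_M]` as a six-fold sum. -/
theorem integral_quadForm_mul_quadForm_mul_quadForm (hX : IsGaussianProcess X P) (h0 : ∀ s, ∫ ω, X s ω ∂P = 0)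
    (t : κ → T) (C : κ → κ → ℝ) (hC : ∀ a b, C a b = ∫ ω, X (t a) ω * X (t b) ω ∂P) (A B M : κ → κ → ℝ)
    {QA QB QM : Ω → ℝ} (hQA : ∀ ω, QA ω = ∑ a, ∑ a', A a a' * (X (t a) ω * X (t a') ω))
    (hQB : ∀ ω, QB ω = ∑ b, ∑ b', B b b' * (X (t b) ω * X (t b') ω))
    (hQM : ∀ ω, QM ω = ∑ c, ∑ c', M c c' * (X (t c) ω * X (t c') ω)) :
    ∫ ω, QA ω * QB ω * QM ω ∂P =
      ∑ a, ∑ a', ∑ b, ∑ b', ∑ c, ∑ c', A a a' * B b b' * M c c' *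
        (C a a' * (C b b' * C c c' + C b c * C b' c' + C b c' * C b' c) +
          C a b * (C a' b' * C c c' + C a' c * C b' c' + C a' c' * C b' c) +
          C a b' * (C a' b * C c c' + C a' c * C b c' + C a' c' * C b c) +
          C a c * (C a' b * C b' c' + C a' b' * C b c' + C a' c' * C b b') +
          C a c' * (C a' b * C b' c + C a' b' * C b c + C a' c * C b b')) := by
  classical
  have hprod : ∀ ω, QA ω * QB ω * QM ω = ∑ a, ∑ a', ∑ b, ∑ b', ∑ c, ∑ c', A a a' * B b b' * M c c' *
      (X (t a) ω * X (t a') ω * X (t b) ω * X (t b') ω * X (t c) ω * X (t c') ω) := by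
    intro ω
    rw [hQA ω, hQB ω, hQM ω, sum2_mul_sum2_mul_sum2]
    exact sum6_congr fun _ _ _ _ _ _ => by ring
  simp_rw [hprod]
  have hint : ∀ a a' b b' c c', Integrable (fun ω => A a a' * B b b' * M c c' *
      (X (t a) ω * X (t a') ω * X (t b) ω * X (t b') ω * X (t c) ω * X (t c') ω)) P := fun a a' b b' c c' =>
    (integrable_mul_six hX _ _ _ _ _ _).const_mul _
  have hswap : ∫ ω, ∑ a, ∑ a', ∑ b, ∑ b', ∑ c, ∑ c', A a a' * B b b' * M c c' *
        (X (t a) ω * X (t a') ω * X (t b) ω * X (t b') ω * X (t c) ω * X (t c') ω) ∂P =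
      ∑ a, ∑ a', ∑ b, ∑ b', ∑ c, ∑ c', ∫ ω, A a a' * B b b' * M c c' *
        (X (t a) ω * X (t a') ω * X (t b) ω * X (t b') ω * X (t c) ω * X (t c') ω) ∂P := by
    simp_rw [sum6_eq_sum_prod]
    rw [integral_finsetSum _ fun z _ => hint _ _ _ _ _ _]
  rw [hswap]
  refine sum6_congr fun a a' b b' c c' => ?_
  rw [integral_const_mul, integral_prod_six hX h0, integral_mul_four hX h0, integral_mul_four hX h0,
    integral_mul_four hX h0, integral_mul_four hX h0, integral_mul_four hX h0]
  simp only [← hC]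

end Moments

/-! ## The third joint cumulant -/

section Cumulant

variable {κ : Type*} [Fintype κ]

/-- ★★ **Third joint cumulant of three quadratic forms of a centred Gaussian process**: only the eight connected pairings survive. -/
theorem cum3_quadForm_eq (hX : IsGaussianProcess X P) (h0 : ∀ s, ∫ ω, X s ω ∂P = 0) (t : κ → T) (C : κ → κ → ℝ)
    (hC : ∀ a b, C a b = ∫ ω, X (t a) ω * X (t b) ω ∂P) (A B M : κ → κ → ℝ) {QA QB QM : Ω → ℝ}
    (hQA : ∀ ω, QA ω = ∑ a, ∑ a', A a a' * (X (t a) ω * X (t a') ω))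
    (hQB : ∀ ω, QB ω = ∑ b, ∑ b', B b b' * (X (t b) ω * X (t b') ω))
    (hQM : ∀ ω, QM ω = ∑ c, ∑ c', M c c' * (X (t c) ω * X (t c') ω)) :
    (∫ ω, QA ω * QB ω * QM ω ∂P) - (∫ ω, QA ω ∂P) * (∫ ω, QB ω * QM ω ∂P) - (∫ ω, QB ω ∂P) * (∫ ω, QA ω * QM ω ∂P) -
        (∫ ω, QM ω ∂P) * (∫ ω, QA ω * QB ω ∂P) + 2 * ((∫ ω, QA ω ∂P) * (∫ ω, QB ω ∂P) * (∫ ω, QM ω ∂P)) =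
      ∑ a, ∑ a', ∑ b, ∑ b', ∑ c, ∑ c', A a a' * B b b' * M c c' *
        (C a b * C a' c * C b' c' + C a b * C a' c' * C b' c + C a b' * C a' c * C b c' + C a b' * C a' c' * C b c +
          C a c * C a' b * C b' c' + C a c * C a' b' * C b c' + C a c' * C a' b * C b' c + C a c' * C a' b' * C b c) := by
  rw [integral_quadForm_mul_quadForm_mul_quadForm hX h0 t C hC A B M hQA hQB hQM,
    integral_quadForm_mul_quadForm hX h0 t C hC B M hQB hQM, integral_quadForm_mul_quadForm hX h0 t C hC A M hQA hQM,
    integral_quadForm_mul_quadForm hX h0 t C hC A B hQA hQB, integral_quadForm hX t C hC A hQA,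
    integral_quadForm hX t C hC B hQB, integral_quadForm hX t C hC M hQM]
  -- every product of sums as a six-fold sum in the order `a a' b b' c c'`
  rw [sum2_mul_sum4, mul_comm (∑ b, ∑ b', B b b' * C b b') _, sum4_mul_sum2, mul_comm (∑ c, ∑ c', M c c' * C c c') _,
    sum4_mul_sum2, sum2_mul_sum2_mul_sum2]
  have hre : (∑ a, ∑ a', ∑ c, ∑ c', ∑ b, ∑ b',
      A a a' * M c c' * (C a a' * C c c' + C a c * C a' c' + C a c' * C a' c) * (B b b' * C b b')) =
      ∑ a, ∑ a', ∑ b, ∑ b', ∑ c, ∑ c',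
        A a a' * M c c' * (C a a' * C c c' + C a c * C a' c' + C a c' * C a' c) * (B b b' * C b b') :=
    Finset.sum_congr rfl fun a _ => Finset.sum_congr rfl fun a' _ =>
      sum4_comm22 (fun b b' c c' => A a a' * M c c' * (C a a' * C c c' + C a c * C a' c' + C a c' * C a' c) * (B b b' * C b b'))
  rw [hre]
  simp only [sum6_eq_sum_prod, Finset.mul_sum, ← Finset.sum_sub_distrib, ← Finset.sum_add_distrib]
  exact Finset.sum_congr rfl fun z _ => by ring

/-- ★ **Symmetric coefficients**: all eight triangles coincide, `κ₃ = 8·Σ A_{aa'}B_{bb'}M_{cc'}·C_{a'b}C_{b'c}C_{c'a}` (`= 8·tr(ACBCMC)`). -/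
theorem cum3_quadForm_eq_symm (hX : IsGaussianProcess X P) (h0 : ∀ s, ∫ ω, X s ω ∂P = 0) (t : κ → T) (C : κ → κ → ℝ)
    (hC : ∀ a b, C a b = ∫ ω, X (t a) ω * X (t b) ω ∂P) (A B M : κ → κ → ℝ) (hA : ∀ a a', A a a' = A a' a)
    (hB : ∀ b b', B b b' = B b' b) (hM : ∀ c c', M c c' = M c' c) {QA QB QM : Ω → ℝ}
    (hQA : ∀ ω, QA ω = ∑ a, ∑ a', A a a' * (X (t a) ω * X (t a') ω))
    (hQB : ∀ ω, QB ω = ∑ b, ∑ b', B b b' * (X (t b) ω * X (t b') ω))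
    (hQM : ∀ ω, QM ω = ∑ c, ∑ c', M c c' * (X (t c) ω * X (t c') ω)) :
    (∫ ω, QA ω * QB ω * QM ω ∂P) - (∫ ω, QA ω ∂P) * (∫ ω, QB ω * QM ω ∂P) - (∫ ω, QB ω ∂P) * (∫ ω, QA ω * QM ω ∂P) -
        (∫ ω, QM ω ∂P) * (∫ ω, QA ω * QB ω ∂P) + 2 * ((∫ ω, QA ω ∂P) * (∫ ω, QB ω ∂P) * (∫ ω, QM ω ∂P)) =
      8 * ∑ a, ∑ a', ∑ b, ∑ b', ∑ c, ∑ c', A a a' * B b b' * M c c' * (C a' b * C b' c * C c' a) := by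
  have hCs : ∀ a b, C a b = C b a := fun a b => by
    rw [hC, hC]; exact integral_congr_ae (ae_of_all _ fun ω => mul_comm _ _)
  rw [cum3_quadForm_eq hX h0 t C hC A B M hQA hQB hQM]
  -- split the eight triangles
  rw [sum6_congr (g := fun a a' b b' c c' =>
      A a a' * B b b' * M c c' * (C a b * C a' c * C b' c') + A a a' * B b b' * M c c' * (C a b * C a' c' * C b' c) +
      A a a' * B b b' * M c c' * (C a b' * C a' c * C b c') + A a a' * B b b' * M c c' * (C a b' * C a' c' * C b c) +
      A a a' * B b b' * M c c' * (C a c * C a' b * C b' c') + A a a' * B b b' * M c c' * (C a c * C a' b' * C b c') +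
      A a a' * B b b' * M c c' * (C a c' * C a' b * C b' c) + A a a' * B b b' * M c c' * (C a c' * C a' b' * C b c))
    fun _ _ _ _ _ _ => by ring]
  simp only [Finset.sum_add_distrib]
  -- each triangle is the canonical one after relabelling inside the forms
  have h1 : (∑ a, ∑ a', ∑ b, ∑ b', ∑ c, ∑ c', A a a' * B b b' * M c c' * (C a b * C a' c * C b' c')) =
      ∑ a, ∑ a', ∑ b, ∑ b', ∑ c, ∑ c', A a a' * B b b' * M c c' * (C a' b * C b' c * C c' a) := by
    rw [sum6_swap_a, sum6_swap_c]
    exact sum6_congr fun a a' b b' c c' => by rw [hA a' a, hM c' c, hCs a c']; ring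
  have h2 : (∑ a, ∑ a', ∑ b, ∑ b', ∑ c, ∑ c', A a a' * B b b' * M c c' * (C a b * C a' c' * C b' c)) =
      ∑ a, ∑ a', ∑ b, ∑ b', ∑ c, ∑ c', A a a' * B b b' * M c c' * (C a' b * C b' c * C c' a) := by
    rw [sum6_swap_a]
    exact sum6_congr fun a a' b b' c c' => by rw [hA a' a, hCs a c']; ring
  have h3 : (∑ a, ∑ a', ∑ b, ∑ b', ∑ c, ∑ c', A a a' * B b b' * M c c' * (C a b' * C a' c * C b c')) =
      ∑ a, ∑ a', ∑ b, ∑ b', ∑ c, ∑ c', A a a' * B b b' * M c c' * (C a' b * C b' c * C c' a) := by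
    rw [sum6_swap_a, sum6_swap_b, sum6_swap_c]
    exact sum6_congr fun a a' b b' c c' => by rw [hA a' a, hB b' b, hM c' c, hCs a c']; ring
  have h4 : (∑ a, ∑ a', ∑ b, ∑ b', ∑ c, ∑ c', A a a' * B b b' * M c c' * (C a b' * C a' c' * C b c)) =
      ∑ a, ∑ a', ∑ b, ∑ b', ∑ c, ∑ c', A a a' * B b b' * M c c' * (C a' b * C b' c * C c' a) := by
    rw [sum6_swap_a, sum6_swap_b]
    exact sum6_congr fun a a' b b' c c' => by rw [hA a' a, hB b' b, hCs a c']; ring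
  have h5 : (∑ a, ∑ a', ∑ b, ∑ b', ∑ c, ∑ c', A a a' * B b b' * M c c' * (C a c * C a' b * C b' c')) =
      ∑ a, ∑ a', ∑ b, ∑ b', ∑ c, ∑ c', A a a' * B b b' * M c c' * (C a' b * C b' c * C c' a) := by
    rw [sum6_swap_c]
    exact sum6_congr fun a a' b b' c c' => by rw [hM c' c, hCs a c']; ring
  have h6 : (∑ a, ∑ a', ∑ b, ∑ b', ∑ c, ∑ c', A a a' * B b b' * M c c' * (C a c * C a' b' * C b c')) =
      ∑ a, ∑ a', ∑ b, ∑ b', ∑ c, ∑ c', A a a' * B b b' * M c c' * (C a' b * C b' c * C c' a) := by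
    rw [sum6_swap_b, sum6_swap_c]
    exact sum6_congr fun a a' b b' c c' => by rw [hB b' b, hM c' c, hCs a c']; ring
  have h7 : (∑ a, ∑ a', ∑ b, ∑ b', ∑ c, ∑ c', A a a' * B b b' * M c c' * (C a c' * C a' b * C b' c)) =
      ∑ a, ∑ a', ∑ b, ∑ b', ∑ c, ∑ c', A a a' * B b b' * M c c' * (C a' b * C b' c * C c' a) :=
    sum6_congr fun a a' b b' c c' => by rw [hCs a c']; ring
  have h8 : (∑ a, ∑ a', ∑ b, ∑ b', ∑ c, ∑ c', A a a' * B b b' * M c c' * (C a c' * C a' b' * C b c)) =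
      ∑ a, ∑ a', ∑ b, ∑ b', ∑ c, ∑ c', A a a' * B b b' * M c c' * (C a' b * C b' c * C c' a) := by
    rw [sum6_swap_b]
    exact sum6_congr fun a a' b b' c c' => by rw [hB b' b, hCs a c']; ring
  rw [h1, h2, h3, h4, h5, h6, h7, h8]
  ring

end Cumulant

end QuadCum3

end Summit.QuantumFields.YangMills.Theorems.AllWindowsColdBoxBoxHighLine

end
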